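import Mathlib
import HarnessLib
import Summits.HubbardSuperconductivity.HubbardSuperconductivity.Theorems.KLProgrammeKLRegimeVolumeLimitDressedModeDecay
import Summits.HubbardSuperconductivity.HubbardSuperconductivity.Theorems.KLProgrammeKLRegimeVolumeLimitSixHamiltonian
import Summits.HubbardSuperconductivity.HubbardSuperconductivity.Theorems.KLProgrammeKLRegimeVolumeLimitGenericStubs
import Summits.HubbardSuperconductivity.HubbardSuperconductivity.Theorems.KLProgrammeKLRegimeVolumeLimitPerLabelThresholds

/-!
# THE ONE-VOLUME MOMENTUM MODULUS (M) OF THE VL CARRIER IS A THEOREM — for every coupling, every bundle and every window;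
# the VL child of K3 then owes NESTED SAME-POINT COMPARABILITY (N) ONLY
# (seat hubbard-kl-k3c5-p3 g6, technique «OS-positivity-free direct assembly»; `--supports` the VL child, stmt-…-19921 / gen-6 successor)

Route `KLProgramme`, crux K3 `KLRegimeTwoPointLimit`, child VOLUME-LIMIT (`VolumeLimitP2 Pr FinalTwoLegVolLimitEx W`).  The doors of this lineage
(`carrierRateText_of_nested`, `…_of_perLabelNested`, `…_of_perLabelThresholds`, `…_of_sitePeriodisation`; `…VolumeLimitNestedGeneric`, `…PerLabel*`,
`…GenericStubs`) reduce the child's ONE stub `stub_vl_carrierRate` to a NESTED two-volume comparability (N) of the bare last-scale self-energy plus a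
ONE-volume torus-Lipschitz momentum modulus (M) `‖Σ̂⁰_{L,M}(ω,k₁) − Σ̂⁰_{L,M}(ω,k₂)‖ ≤ ρ′ L + D·Σ_i|p_{k₁,i} − p_{k₂,i}|_𝕋` with `D` uniform in `(L, M, ω)`.
Plan g14 (R15)(ii)/(E3-M) booked (M) as ENGINE content (first site moments of the two-leg kernel at every scale, a private invariant
`TwoLegKernelMoments` of the gen-6 engine skeleton).  THIS FILE PROVES (M) OUTRIGHT, FOR EVERY COUPLING, so that private invariant is not needed by
the VL child:

* §0 `ThermalGreen.norm_shiftedDressedMatsubara_sub_le` — `∃ C(β,U,μ)`: for EVERY side `L`, every fermionic `k` with `|k| ≥ π/β`, all momenta: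
  `‖𝒵′(k,p₁) − 𝒵′(k,p₂)‖ ≤ C·Σ_i|Δp_i|_𝕋`, `𝒵′(k,p) = ∫₀^β e^{ikτ}⟨T′_{−p}(τ)T′_{−p}†⟩_{H}` (…DressedModeDecay: Bloch sum over MOMENTUM-INDEPENDENT
  single-site pairs with decay `e^{−γ dist}`, `|χ_{p₁}(x−y) − χ_{p₂}(x−y)| ≤ 2 dist(x,y)·Σ_i|Δp_i|_𝕋`, radial lattice sum);
* §1 `norm_klSixInf_sub_le` — `∃ C(β,U,μ) ∀ L ≥ 3 ∀ n p₁ p₂: ‖Six∞_L(n,p₁) − Six∞_L(n,p₂)‖ ≤ C·Σ_i|Δp_i|_𝕋` (`U ≠ 0`): k3c5-p1's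
  `Six∞_L(n,p) = −𝒵′(k₀(n),p)` (`klSixInf_eq_neg_shiftedDressedMatsubara`, the two-time Matsubara transform of the half-shifted dressed mode) and this
  seat's `norm_shiftedDressedMatsubara_sub_le` (…DressedModeDecay: fermionic KMS/resolvent transfer × the tree's anticommutator light cone — Hastings'
  mechanism in Matsubara form; the dressed site modes are odd, single-site and anticommute at distinct sites, so every Matsubara coefficient of their
  two-time function decays exponentially in the torus distance, uniformly in `L` and in the label);
* §2 `norm_klSelfEnergyInf_zero_sub_le` — the same for the cutoff-free bare carrier `Σ∞⁰ = U·occ∞ + U²·Six∞` (`klSelfEnergyInf_zero_frame`), `D = U²C`;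
* §3 `klSelfEnergy_momentumModulus_eventually` — finite cutoffs: for `L ≥ 3`, eventually in `M`, ALL labels `ω` and momenta `k₁, k₂`:
  `‖Σ̂⁰_{L,M}(ω,k₁) − Σ̂⁰_{L,M}(ω,k₂)‖ ≤ 1/(L+1) + D·Σ_i|Δp_i|_𝕋` (this seat's label-uniform cutoff removal `klSelfEnergy_cutoffLimit_labelUniform`);
* §4 **`modulusText_holds (Pr W)`** — the `hM` text of `carrierRateText_of_nested` / `volumeLimitP2_of_nestedCarrierText` / `…perLabel…` HOLDS for every
  bundle `Pr` and window `W` (`L₀ = 3`, `ρ′ L = 1/(L+1)`);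
* §5 doors WITHOUT the modulus hypothesis: `carrierRateText_of_nestedOnly`, `volumeLimitP2_of_nestedOnlyText`, `volumeLimitP2_of_perLabelNestedOnlyText`,
  `volumeLimitP2_of_perLabelThresholdsOnlyText` — a VL child of ANY generation closes from nested (`L ∣ L″`), same-point, same-cutoff comparability of
  `klSelfEnergy L M β U μ 0 klE0 (nScales β + 1) (ω,k) 0` alone (label by label, label-dependent rates and thresholds allowed).

Why (N) is not reachable the same way: `⟨{τ_t(A_z), A_w†}⟩` is an EVEN local observable whose torus-Gibbs EXPECTATION must be compared across two
volumes — the engine lineage's two-volume pass; the modulus only ever needed the operator NORM of the anticommutator.  Everything is proved; no definition.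
-/

noncomputable section

namespace Summit.HubbardSuperconductivity.HubbardSuperconductivity.Theorems.ThermalGreen

set_option linter.dupNamespace false -- summit = problem name (single-conjunct summit), D-0017

open scoped Matrix.Norms.L2Operator ComplexConjugate
open Matrix Complex MeasureTheory intervalIntegral Finset Literature.MathematicalPhysics.QuantumLattice Literature.Probability.LatticeModels

/-! ## §0 The momentum modulus of `𝒵′`, uniform in the volume and the label (Hamiltonian side) -/

section Modulus

open Summit.HubbardSuperconductivity.HubbardSuperconductivity.Theorems.KLProgrammeLegKernels

/-- **THE MOMENTUM MODULUS OF THE DRESSED TWO-TIME FUNCTION, FOR EVERY COUPLING.**  For every `U, μ` and `β > 0` there is `C = C(β,U,μ)` such that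
for EVERY side `L`, every fermionic frequency `k` (`e^{ikβ} = −1`) with `|k| ≥ π/β` and all torus momenta `p₁, p₂`:
`‖𝒵′(k,p₁) − 𝒵′(k,p₂)‖ ≤ C · Σ_i |p₁,ᵢ − p₂,ᵢ|_𝕋`, `𝒵′(k,p) = ∫₀^β e^{ikτ}⟨T′_{−p}(τ)T′_{−p}†⟩_{H}`, `H = hubbardTorusWith 2 L 1 U μ`
(explicitly `C = 2·(9/4)(5β/π)·Σ'_r 4(2r+1)·r·e^{−γr}`, `γ = min(1/2, π/(8κβ))`). -/
theorem norm_shiftedDressedMatsubara_sub_le (U μ : ℝ) {β : ℝ} (hβ : 0 < β) :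
    ∃ C : ℝ, ∀ (L : ℕ) [NeZero L] [DecidableEq (FermionTorus 2 L)] (k : ℝ), cexp (I * k * β) = -1 → Real.pi / β ≤ |k| →
      ∀ p₁ p₂ : TorusSite 2 L,
        ‖(∫ τ in (0 : ℝ)..β, cexp (I * k * τ) * gibbsState β (hubbardTorusWith 2 L 1 U μ)
            (imagTimeEvolve (hubbardTorusWith 2 L 1 U μ) (τ : ℂ)
              ((∑ z : FermionTorus 2 L, (torusFourierWeight 2 L * torusChar (-p₁) z.toTorusSite) • (numberOp z 1 * creation (orb z 0)))ᴴ -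
                (1 / 2 : ℂ) • momentumAnnihilation (-p₁) 0) *
              ((∑ z : FermionTorus 2 L, (torusFourierWeight 2 L * torusChar (-p₁) z.toTorusSite) • (numberOp z 1 * creation (orb z 0)))ᴴ -
                (1 / 2 : ℂ) • momentumAnnihilation (-p₁) 0)ᴴ)) -
          ∫ τ in (0 : ℝ)..β, cexp (I * k * τ) * gibbsState β (hubbardTorusWith 2 L 1 U μ)
            (imagTimeEvolve (hubbardTorusWith 2 L 1 U μ) (τ : ℂ)
              ((∑ z : FermionTorus 2 L, (torusFourierWeight 2 L * torusChar (-p₂) z.toTorusSite) • (numberOp z 1 * creation (orb z 0)))ᴴ -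
                (1 / 2 : ℂ) • momentumAnnihilation (-p₂) 0) *
              ((∑ z : FermionTorus 2 L, (torusFourierWeight 2 L * torusChar (-p₂) z.toTorusSite) • (numberOp z 1 * creation (orb z 0)))ᴴ -
                (1 / 2 : ℂ) • momentumAnnihilation (-p₂) 0)ᴴ)‖ ≤
          C * ∑ i, torusAbs (latticeMomentum L p₁ i - latticeMomentum L p₂ i) := by
  set κ : ℝ := Real.exp 1 * (2 * (2 * |(1 : ℝ)| + |U| + 2 * |μ|) * (2 * (2 * 4 + 1) : ℕ)) with hκ
  have hJpos : 0 < 2 * |(1 : ℝ)| + |U| + 2 * |μ| := by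
    have h1 : |(1 : ℝ)| = 1 := abs_one
    have := abs_nonneg U; have := abs_nonneg μ; linarith
  have hκpos : 0 < κ := by positivity
  set γ : ℝ := min (1 / 2 : ℝ) (Real.pi / (8 * κ * β)) with hγ
  have hγpos : 0 < γ := lt_min (by norm_num) (by positivity)
  set c : ℝ := (3 / 2) * (3 / 2) * (5 * β / Real.pi) with hc
  have hcpos : 0 < c := by positivity
  set S : ℝ := ∑' r : ℕ, (4 * (2 * (r : ℝ) + 1)) * ((r : ℝ) * Real.exp (-(γ * r))) with hS
  refine ⟨2 * c * S, ?_⟩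
  intro L _ instDE k hk hka p₁ p₂
  -- instance bookkeeping (see `norm_anticommutator_hubbardTorus_le`)
  obtain rfl : instDE = LinearOrder.toDecidableEq := Subsingleton.elim _ _
  letI instDE : DecidableEq (FermionTorus 2 L) := LinearOrder.toDecidableEq
  set H := hubbardTorusWith 2 L 1 U μ with hH_def
  -- the momentum-independent single-site Matsubara functions
  set h : TorusSite 2 L → TorusSite 2 L → ℂ := fun x y =>
    ∫ τ in (0 : ℝ)..β, cexp (I * k * τ) * gibbsState β H (imagTimeEvolve H (τ : ℂ)
      (annihilation (orb (FermionTorus.ofTorusSite x) 0) * numberOp (FermionTorus.ofTorusSite x) 1 -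
        (1 / 2 : ℂ) • annihilation (orb (FermionTorus.ofTorusSite x) 0)) *
      (annihilation (orb (FermionTorus.ofTorusSite y) 0) * numberOp (FermionTorus.ofTorusSite y) 1 -
        (1 / 2 : ℂ) • annihilation (orb (FermionTorus.ofTorusSite y) 0))ᴴ) with hh
  set wL : ℂ := torusFourierWeight 2 L with hwL
  set Θ : ℝ := ∑ i, torusAbs (latticeMomentum L p₁ i - latticeMomentum L p₂ i) with hΘ
  have hθnn : ∀ i, 0 ≤ torusAbs (latticeMomentum L p₁ i - latticeMomentum L p₂ i) := fun i => abs_nonneg _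
  have hΘnn : 0 ≤ Θ := Finset.sum_nonneg fun i _ => hθnn i
  rw [shiftedDressedMatsubara_eq_sum U μ β k p₁, shiftedDressedMatsubara_eq_sum U μ β k p₂]
  change ‖(∑ x : TorusSite 2 L, ∑ y : TorusSite 2 L, wL * torusChar p₁ x * (wL * conj (torusChar p₁ y) * h x y)) -
      ∑ x : TorusSite 2 L, ∑ y : TorusSite 2 L, wL * torusChar p₂ x * (wL * conj (torusChar p₂ y) * h x y)‖ ≤ 2 * c * S * Θ
  -- per-pair: `|coefficient difference| ≤ ‖wL‖²·2·dist·Θ`, `‖h x y‖ ≤ c e^{−γ dist}` off the diagonal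
  have hcoef : ∀ x y : TorusSite 2 L,
      ‖wL * torusChar p₁ x * (wL * conj (torusChar p₁ y)) - wL * torusChar p₂ x * (wL * conj (torusChar p₂ y))‖ ≤
        ‖wL‖ ^ 2 * (2 * (torusDist x y : ℝ) * Θ) := by
    intro x y
    have e : wL * torusChar p₁ x * (wL * conj (torusChar p₁ y)) - wL * torusChar p₂ x * (wL * conj (torusChar p₂ y)) =
        wL * wL * (torusChar p₁ (x - y) - torusChar p₂ (x - y)) := by
      rw [torusChar_sub_right, torusChar_sub_right]; ring
    rw [e, norm_mul, norm_mul, ← sq]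
    refine mul_le_mul_of_nonneg_left ?_ (sq_nonneg _)
    refine (Summit.HubbardSuperconductivity.HubbardSuperconductivity.Theorems.TwoPointAssembly.norm_torusChar_sub_torusChar_le p₁ p₂ (x - y)).trans ?_
    calc ∑ i, |(Torus.cRepZ ((x - y) i) : ℝ)| * torusAbs (latticeMomentum L p₁ i - latticeMomentum L p₂ i)
        ≤ ∑ i, |(Torus.cRepZ ((x - y) i) : ℝ)| * Θ :=
          Finset.sum_le_sum fun i _ => mul_le_mul_of_nonneg_left
            (Finset.single_le_sum (f := fun j => torusAbs (latticeMomentum L p₁ j - latticeMomentum L p₂ j))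
              (fun j _ => hθnn j) (Finset.mem_univ i)) (abs_nonneg _)
      _ = (∑ i, |(Torus.cRepZ ((x - y) i) : ℝ)|) * Θ := by rw [Finset.sum_mul]
      _ ≤ (2 * (torusDist x y : ℝ)) * Θ := mul_le_mul_of_nonneg_right (by exact_mod_cast sum_abs_cRepZ_sub_le x y) hΘnn
      _ = 2 * (torusDist x y : ℝ) * Θ := by ring
  have hpair : ∀ x y : TorusSite 2 L, (torusDist x y : ℝ) * ‖h x y‖ ≤ (torusDist x y : ℝ) * (c * Real.exp (-(γ * torusDist x y))) := by
    intro x y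
    by_cases hxy : x = y
    · subst hxy; simp
    · exact mul_le_mul_of_nonneg_left (norm_dressedPair_matsubara_le U μ hβ hk hka hxy) (Nat.cast_nonneg _)
  -- assemble
  have hwL : ‖wL‖ ^ 2 * (Fintype.card (TorusSite 2 L) : ℝ) = 1 := by
    rw [hwL, torusFourierWeight_two, norm_inv, Complex.norm_natCast]
    have hL : (L : ℝ) ≠ 0 := Nat.cast_ne_zero.mpr (NeZero.ne L)
    have hcard : (Fintype.card (TorusSite 2 L) : ℝ) = (L : ℝ) ^ 2 := by
      rw [Fintype.card_fun, ZMod.card, Fintype.card_fin]; push_cast; ring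
    rw [hcard]; field_simp
  calc ‖(∑ x : TorusSite 2 L, ∑ y : TorusSite 2 L, wL * torusChar p₁ x * (wL * conj (torusChar p₁ y) * h x y)) -
          ∑ x : TorusSite 2 L, ∑ y : TorusSite 2 L, wL * torusChar p₂ x * (wL * conj (torusChar p₂ y) * h x y)‖
      = ‖∑ x : TorusSite 2 L, ∑ y : TorusSite 2 L,
          (wL * torusChar p₁ x * (wL * conj (torusChar p₁ y)) - wL * torusChar p₂ x * (wL * conj (torusChar p₂ y))) * h x y‖ := by
        rw [← Finset.sum_sub_distrib]
        congr 1
        refine Finset.sum_congr rfl fun x _ => ?_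
        rw [← Finset.sum_sub_distrib]
        refine Finset.sum_congr rfl fun y _ => ?_
        ring
    _ ≤ ∑ x : TorusSite 2 L, ∑ y : TorusSite 2 L, ‖wL‖ ^ 2 * (2 * (torusDist x y : ℝ) * Θ) * ‖h x y‖ := by
        refine (norm_sum_le _ _).trans (Finset.sum_le_sum fun x _ => (norm_sum_le _ _).trans (Finset.sum_le_sum fun y _ => ?_))
        rw [norm_mul]
        exact mul_le_mul_of_nonneg_right (hcoef x y) (norm_nonneg _)
    _ = 2 * Θ * ‖wL‖ ^ 2 * ∑ y : TorusSite 2 L, ∑ x : TorusSite 2 L, (torusDist x y : ℝ) * ‖h x y‖ := by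
        rw [Finset.sum_comm, Finset.mul_sum]
        refine Finset.sum_congr rfl fun y _ => ?_
        rw [Finset.mul_sum]
        refine Finset.sum_congr rfl fun x _ => ?_
        ring
    _ ≤ 2 * Θ * ‖wL‖ ^ 2 * ∑ _y : TorusSite 2 L, c * S := by
        refine mul_le_mul_of_nonneg_left (Finset.sum_le_sum fun y _ => ?_) (by positivity)
        calc ∑ x : TorusSite 2 L, (torusDist x y : ℝ) * ‖h x y‖
            ≤ ∑ x : TorusSite 2 L, (torusDist x y : ℝ) * (c * Real.exp (-(γ * torusDist x y))) := Finset.sum_le_sum fun x _ => hpair x y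
          _ = c * ∑ x : TorusSite 2 L, (torusDist x y : ℝ) * Real.exp (-(γ * torusDist x y)) := by
              rw [Finset.mul_sum]; refine Finset.sum_congr rfl fun x _ => ?_; ring
          _ ≤ c * S := mul_le_mul_of_nonneg_left (sum_torusDist_mul_exp_le hγpos y) hcpos.le
    _ = 2 * c * S * Θ * (‖wL‖ ^ 2 * (Fintype.card (TorusSite 2 L) : ℝ)) := by
        rw [Finset.sum_const, Finset.card_univ, nsmul_eq_mul]; ring
    _ = 2 * c * S * Θ := by rw [hwL, mul_one]

end Modulus

end Summit.HubbardSuperconductivity.HubbardSuperconductivity.Theorems.ThermalGreen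

namespace Summit.HubbardSuperconductivity.HubbardSuperconductivity.Theorems.TwoPointAssembly

set_option linter.dupNamespace false -- summit = problem name (single-conjunct summit), D-0017

open Finset Filter Topology Complex Literature.MathematicalPhysics.QuantumLattice Literature.Probability.LatticeModels
open Literature.MathematicalPhysics.QuantumLattice.FermiRG
open Summit.HubbardSuperconductivity.HubbardSuperconductivity.Theorems.DispersionFlow
open Summit.HubbardSuperconductivity.HubbardSuperconductivity.Theorems.KLRegimeSplit
open Summit.HubbardSuperconductivity.HubbardSuperconductivity.Theorems.KLProgrammeLegKernels
open Summit.HubbardSuperconductivity.HubbardSuperconductivity.Theorems.ThermalGreen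

/-! ## §1 The momentum modulus of the cutoff-free six-point scalar `Six∞_L(n,p)` -/

/-- **`‖Six∞_L(n,p₁) − Six∞_L(n,p₂)‖ ≤ C·Σ_i |p₁,ᵢ − p₂,ᵢ|_𝕋`** with `C = C(β,U,μ)` INDEPENDENT of the side `L ≥ 3`, the Matsubara integer `n` and the momenta
(`U ≠ 0`, `β > 0`). -/
theorem norm_klSixInf_sub_le (U μ : ℝ) {β : ℝ} (hβ : 0 < β) (hU : U ≠ 0) :
    ∃ C : ℝ, ∀ (L : ℕ) [NeZero L], 3 ≤ L → ∀ (n : ℤ) (p₁ p₂ : TorusSite 2 L),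
      ‖klSixInf L β U μ n p₁ - klSixInf L β U μ n p₂‖ ≤ C * ∑ i, torusAbs (latticeMomentum L p₁ i - latticeMomentum L p₂ i) := by
  obtain ⟨C, hC⟩ := norm_shiftedDressedMatsubara_sub_le U (μ + U / 2) hβ
  refine ⟨C, fun L _ hL n p₁ p₂ => ?_⟩
  have hk : cexp (I * ((Real.pi * (2 * (n : ℝ) + 1) / β : ℝ) : ℂ) * β) = -1 := by
    have h := cexp_fermiMatsubara_mul_beta hβ.ne' n
    simp only [fermiMatsubara] at h
    exact h
  have hka : Real.pi / β ≤ |(Real.pi * (2 * (n : ℝ) + 1) / β : ℝ)| := by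
    have h := Literature.MathematicalPhysics.QuantumLattice.pi_div_le_abs_fermiMatsubara hβ n
    simp only [fermiMatsubara] at h
    exact h
  have h := hC L (Real.pi * (2 * (n : ℝ) + 1) / β) hk hka p₁ p₂
  rw [klSixInf_eq_neg_shiftedDressedMatsubara hL hβ hU μ n p₁, klSixInf_eq_neg_shiftedDressedMatsubara hL hβ hU μ n p₂, neg_sub_neg,
    norm_sub_rev]
  exact h

/-! ## §2 The momentum modulus of the cutoff-free bare carrier `Σ∞⁰_L(n,p)` -/

/-- **`‖Σ∞⁰_L(n,p₁) − Σ∞⁰_L(n,p₂)‖ ≤ D·Σ_i |p₁,ᵢ − p₂,ᵢ|_𝕋`** with `D = D(β,U,μ)` independent of `L ≥ 3`, `n`, `p₁`, `p₂` (`U ≠ 0`, `β > 0`):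
`Σ∞⁰ = U·occ∞ + U²·Six∞` and §1. -/
theorem norm_klSelfEnergyInf_zero_sub_le (U μ : ℝ) {β : ℝ} (hβ : 0 < β) (hU : U ≠ 0) :
    ∃ D : ℝ, ∀ (L : ℕ) [NeZero L], 3 ≤ L → ∀ (n : ℤ) (p₁ p₂ : TorusSite 2 L),
      ‖klSelfEnergyInf L β U μ 0 n p₁ - klSelfEnergyInf L β U μ 0 n p₂‖ ≤ D * ∑ i, torusAbs (latticeMomentum L p₁ i - latticeMomentum L p₂ i) := by
  obtain ⟨C, hC⟩ := norm_klSixInf_sub_le U μ hβ hU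
  refine ⟨U ^ 2 * C, fun L _ hL n p₁ p₂ => ?_⟩
  rw [klSelfEnergyInf_zero_frame hβ.ne' U μ n p₁, klSelfEnergyInf_zero_frame hβ.ne' U μ n p₂, add_sub_add_left_eq_sub, ← mul_sub, norm_mul,
    norm_pow, Complex.norm_real, Real.norm_eq_abs, sq_abs, mul_assoc]
  exact mul_le_mul_of_nonneg_left (hC L hL n p₁ p₂) (sq_nonneg U)

/-! ## §3 Finite Matsubara cutoffs: the modulus of the VL carrier, eventually in `M`, all labels -/

/-- **The momentum modulus of the finite-cutoff VL carrier**: with `D` from §2, for every `L ≥ 3` there is `M₀` such that for all `M ≥ M₀`, ALL kept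
labels `ω` and all momenta `k₁, k₂`: `‖Σ̂⁰_{L,M}(ω,k₁) − Σ̂⁰_{L,M}(ω,k₂)‖ ≤ 1/(L+1) + D·Σ_i|p_{k₁,i} − p_{k₂,i}|_𝕋` (label-uniform cutoff removal,
`klSelfEnergy_cutoffLimit_labelUniform`, with `ε = 1/(2(L+1))`). -/
theorem klSelfEnergy_momentumModulus_eventually (U μ : ℝ) {β : ℝ} (hβ : 0 < β) (hU : U ≠ 0) :
    ∃ D : ℝ, ∀ (L : ℕ) [NeZero L], 3 ≤ L → ∃ M₀ : ℕ, ∀ (M : ℕ) [NeZero M], M₀ ≤ M →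
      ∀ (ω : MatsubaraIdx M) (k₁ k₂ : TorusSite 2 L),
        ‖klSelfEnergy L M β U μ 0 klE0 (nScales β + 1) (ω, k₁) 0 - klSelfEnergy L M β U μ 0 klE0 (nScales β + 1) (ω, k₂) 0‖ ≤
          1 / ((L : ℝ) + 1) + D * ∑ i, torusAbs (latticeMomentum L k₁ i - latticeMomentum L k₂ i) := by
  obtain ⟨D, hD⟩ := norm_klSelfEnergyInf_zero_sub_le U μ hβ hU
  refine ⟨D, fun L _ hL => ?_⟩
  have hε : (0 : ℝ) < 1 / (2 * ((L : ℝ) + 1)) := by positivity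
  obtain ⟨M₁, hM₁⟩ := klSelfEnergy_cutoffLimit_labelUniform hL hβ U μ 0 hε
  refine ⟨M₁, fun M _ hM ω k₁ k₂ => ?_⟩
  have h1 := hM₁ M hM ω k₁ 0
  have h2 := hM₁ M hM ω k₂ 0
  have h3 := hD L hL (matsubaraInt M ω) k₁ k₂
  calc ‖klSelfEnergy L M β U μ 0 klE0 (nScales β + 1) (ω, k₁) 0 - klSelfEnergy L M β U μ 0 klE0 (nScales β + 1) (ω, k₂) 0‖
      = ‖(klSelfEnergy L M β U μ 0 klE0 (nScales β + 1) (ω, k₁) 0 - klSelfEnergyInf L β U μ 0 (matsubaraInt M ω) k₁) +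
          (klSelfEnergyInf L β U μ 0 (matsubaraInt M ω) k₁ - klSelfEnergyInf L β U μ 0 (matsubaraInt M ω) k₂) -
          (klSelfEnergy L M β U μ 0 klE0 (nScales β + 1) (ω, k₂) 0 - klSelfEnergyInf L β U μ 0 (matsubaraInt M ω) k₂)‖ := by
        congr 1; ring
    _ ≤ ‖klSelfEnergy L M β U μ 0 klE0 (nScales β + 1) (ω, k₁) 0 - klSelfEnergyInf L β U μ 0 (matsubaraInt M ω) k₁‖ +
          ‖klSelfEnergyInf L β U μ 0 (matsubaraInt M ω) k₁ - klSelfEnergyInf L β U μ 0 (matsubaraInt M ω) k₂‖ +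
          ‖klSelfEnergy L M β U μ 0 klE0 (nScales β + 1) (ω, k₂) 0 - klSelfEnergyInf L β U μ 0 (matsubaraInt M ω) k₂‖ :=
        (norm_sub_le _ _).trans (add_le_add (norm_add_le _ _) le_rfl)
    _ ≤ 1 / (2 * ((L : ℝ) + 1)) + D * ∑ i, torusAbs (latticeMomentum L k₁ i - latticeMomentum L k₂ i) + 1 / (2 * ((L : ℝ) + 1)) :=
        add_le_add (add_le_add h1 h3) h2
    _ = 1 / ((L : ℝ) + 1) + D * ∑ i, torusAbs (latticeMomentum L k₁ i - latticeMomentum L k₂ i) := by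
        field_simp; ring

/-! ## §4 The `hM` text of the doors HOLDS for every bundle and window -/

/-- **THE MODULUS TEXT HOLDS (every `Pr`, every `W`)**: the one-volume momentum-modulus hypothesis `hM` of `carrierRateText_of_nested` /
`volumeLimitP2_of_nestedCarrierText` / `carrierRateText_of_perLabelNested` / `carrierRateText_of_perLabelThresholds` is a theorem (`L₀ = 3`,
`ρ′ L = 1/(L+1)`, `D = D(β,U,μ)` of §2; the tower, the frame and the regime are not used). -/
theorem modulusText_holds (Pr : Preds) (W : Set ℝ) :
    ∀ (G : GeoConsts) (P : SplitConsts) (Q : EngConsts) (R : RenConsts), G.WF → P.WF → Q.WF → R.WF →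
      ∃ c₅ : ℝ, 0 < c₅ ∧ ∀ c : ℝ, 0 < c → c ≤ c₅ → ∃ U₀ : ℝ, 0 < U₀ ∧
        ∀ μ ∈ W, ∀ U : ℝ, 0 < U → U ≤ U₀ → ∀ β : ℝ, klBetaMin ≤ β → β ≤ Real.exp (c / U ^ 2) →
          ∀ K : TrigPolyC4v, Pr.frameOK R U (nScales β) μ K →
            ∀ (Lstar : ℕ) (Mstar : ℕ → ℕ), TowerP Pr G P Q R β U μ K Lstar Mstar →
              ∃ L₀ : ℕ, ∃ D : ℝ, ∃ ρ' : ℕ → ℝ, Tendsto ρ' atTop (𝓝 0) ∧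
                ∀ (L : ℕ) [NeZero L], L₀ ≤ L → ∃ M₀ : ℕ, ∀ (M : ℕ) [NeZero M], M₀ ≤ M →
                  ∀ (ω : MatsubaraIdx M) (k₁ k₂ : TorusSite 2 L),
                    ‖klSelfEnergy L M β U μ 0 klE0 (nScales β + 1) (ω, k₁) 0 -
                        klSelfEnergy L M β U μ 0 klE0 (nScales β + 1) (ω, k₂) 0‖ ≤
                      ρ' L + D * ∑ i, torusAbs (latticeMomentum L k₁ i - latticeMomentum L k₂ i) := by
  intro G P Q R _ _ _ _
  refine ⟨1, one_pos, fun c _ _ => ⟨1, one_pos, ?_⟩⟩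
  intro μ _ U hU _ β hβmin _ K _ Lstar Mstar _
  have hβ : 0 < β := pos_of_klBetaMin_le hβmin
  obtain ⟨D, hD⟩ := klSelfEnergy_momentumModulus_eventually U μ hβ hU.ne'
  refine ⟨3, D, fun L => 1 / ((L : ℝ) + 1), tendsto_one_div_add_atTop_nhds_zero_nat, fun L _ hL => ?_⟩
  exact hD L hL

/-! ## §5 Doors without the modulus hypothesis: the VL child from nested same-point comparability ALONE -/

/-- **The carrier-export text (arbitrary volume pairs, cross-grid modulus) from NESTED same-point comparability ALONE** (any `Pr`, `W`). -/
theorem carrierRateText_of_nestedOnly (Pr : Preds) (W : Set ℝ)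
    (hN : ∀ (G : GeoConsts) (P : SplitConsts) (Q : EngConsts) (R : RenConsts), G.WF → P.WF → Q.WF → R.WF →
      ∃ c₅ : ℝ, 0 < c₅ ∧ ∀ c : ℝ, 0 < c → c ≤ c₅ → ∃ U₀ : ℝ, 0 < U₀ ∧
        ∀ μ ∈ W, ∀ U : ℝ, 0 < U → U ≤ U₀ → ∀ β : ℝ, klBetaMin ≤ β → β ≤ Real.exp (c / U ^ 2) →
          ∀ K : TrigPolyC4v, Pr.frameOK R U (nScales β) μ K →
            ∀ (Lstar : ℕ) (Mstar : ℕ → ℕ), TowerP Pr G P Q R β U μ K Lstar Mstar →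
              ∃ L₀ : ℕ, ∃ ρ : ℕ → ℝ, Tendsto ρ atTop (𝓝 0) ∧
                ∀ (L : ℕ) [NeZero L], L₀ ≤ L → ∀ (L'' : ℕ) [NeZero L''], L ∣ L'' → ∃ M₀ : ℕ, ∀ (M : ℕ) [NeZero M], M₀ ≤ M →
                  ∀ (ω : MatsubaraIdx M) (k : TorusSite 2 L) (k'' : TorusSite 2 L''), latticeMomentum L'' k'' = latticeMomentum L k →
                    ‖klSelfEnergy L M β U μ 0 klE0 (nScales β + 1) (ω, k) 0 -
                        klSelfEnergy L'' M β U μ 0 klE0 (nScales β + 1) (ω, k'') 0‖ ≤ ρ L) :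
    ∀ (G : GeoConsts) (P : SplitConsts) (Q : EngConsts) (R : RenConsts), G.WF → P.WF → Q.WF → R.WF →
      ∃ c₅ : ℝ, 0 < c₅ ∧ ∀ c : ℝ, 0 < c → c ≤ c₅ → ∃ U₀ : ℝ, 0 < U₀ ∧
        ∀ μ ∈ W, ∀ U : ℝ, 0 < U → U ≤ U₀ → ∀ β : ℝ, klBetaMin ≤ β → β ≤ Real.exp (c / U ^ 2) →
          ∀ K : TrigPolyC4v, Pr.frameOK R U (nScales β) μ K →
            ∀ (Lstar : ℕ) (Mstar : ℕ → ℕ), TowerP Pr G P Q R β U μ K Lstar Mstar →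
              ∃ L₀ : ℕ, ∃ D : ℝ, ∃ ρ : ℕ → ℝ, Tendsto ρ atTop (𝓝 0) ∧
                ∀ (L : ℕ) [NeZero L], L₀ ≤ L → ∀ (L' : ℕ) [NeZero L'], L ≤ L' → ∃ M₀ : ℕ, ∀ (M : ℕ) [NeZero M], M₀ ≤ M →
                  ∀ (ω : MatsubaraIdx M) (k : TorusSite 2 L) (k' : TorusSite 2 L'),
                    ‖klSelfEnergy L M β U μ 0 klE0 (nScales β + 1) (ω, k) 0 -
                        klSelfEnergy L' M β U μ 0 klE0 (nScales β + 1) (ω, k') 0‖ ≤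
                      ρ L + D * ∑ i, torusAbs (latticeMomentum L k i - latticeMomentum L' k' i) :=
  carrierRateText_of_nested Pr W hN (modulusText_holds Pr W)

/-- **A VL child (any `Pr`, `W`) FROM THE NESTED EXPORT ALONE**: `L ∣ L″`, equal momenta, common cutoff, bare frame, one rate `ρ L → 0` — no modulus,
no site moments, no frame transfer beyond `hPr : Pr.frameOK ⇒ FrameOK`. -/
theorem volumeLimitP2_of_nestedOnlyText (Pr : Preds) (W : Set ℝ)
    (hPr : ∀ (R : RenConsts) (U : ℝ) (N : ℕ) (μ : ℝ) (K : TrigPolyC4v), Pr.frameOK R U N μ K → FrameOK R U N μ K)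
    (hN : ∀ (G : GeoConsts) (P : SplitConsts) (Q : EngConsts) (R : RenConsts), G.WF → P.WF → Q.WF → R.WF →
      ∃ c₅ : ℝ, 0 < c₅ ∧ ∀ c : ℝ, 0 < c → c ≤ c₅ → ∃ U₀ : ℝ, 0 < U₀ ∧
        ∀ μ ∈ W, ∀ U : ℝ, 0 < U → U ≤ U₀ → ∀ β : ℝ, klBetaMin ≤ β → β ≤ Real.exp (c / U ^ 2) →
          ∀ K : TrigPolyC4v, Pr.frameOK R U (nScales β) μ K →
            ∀ (Lstar : ℕ) (Mstar : ℕ → ℕ), TowerP Pr G P Q R β U μ K Lstar Mstar →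
              ∃ L₀ : ℕ, ∃ ρ : ℕ → ℝ, Tendsto ρ atTop (𝓝 0) ∧
                ∀ (L : ℕ) [NeZero L], L₀ ≤ L → ∀ (L'' : ℕ) [NeZero L''], L ∣ L'' → ∃ M₀ : ℕ, ∀ (M : ℕ) [NeZero M], M₀ ≤ M →
                  ∀ (ω : MatsubaraIdx M) (k : TorusSite 2 L) (k'' : TorusSite 2 L''), latticeMomentum L'' k'' = latticeMomentum L k →
                    ‖klSelfEnergy L M β U μ 0 klE0 (nScales β + 1) (ω, k) 0 -
                        klSelfEnergy L'' M β U μ 0 klE0 (nScales β + 1) (ω, k'') 0‖ ≤ ρ L) :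
    VolumeLimitP2 Pr FinalTwoLegVolLimitEx W :=
  volumeLimitP2_of_nestedCarrierText Pr W hPr hN (modulusText_holds Pr W)

/-- **A VL child (any `Pr`, `W`) from the PER-LABEL nested export alone** (one Matsubara integer `n` at a time, label-dependent rates `ρ n L → 0`). -/
theorem volumeLimitP2_of_perLabelNestedOnlyText (Pr : Preds) (W : Set ℝ)
    (hPr : ∀ (R : RenConsts) (U : ℝ) (N : ℕ) (μ : ℝ) (K : TrigPolyC4v), Pr.frameOK R U N μ K → FrameOK R U N μ K)
    (hN : ∀ (G : GeoConsts) (P : SplitConsts) (Q : EngConsts) (R : RenConsts), G.WF → P.WF → Q.WF → R.WF →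
      ∃ c₅ : ℝ, 0 < c₅ ∧ ∀ c : ℝ, 0 < c → c ≤ c₅ → ∃ U₀ : ℝ, 0 < U₀ ∧
        ∀ μ ∈ W, ∀ U : ℝ, 0 < U → U ≤ U₀ → ∀ β : ℝ, klBetaMin ≤ β → β ≤ Real.exp (c / U ^ 2) →
          ∀ K : TrigPolyC4v, Pr.frameOK R U (nScales β) μ K →
            ∀ (Lstar : ℕ) (Mstar : ℕ → ℕ), TowerP Pr G P Q R β U μ K Lstar Mstar →
              ∃ L₀ : ℕ, ∃ ρ : ℤ → ℕ → ℝ, (∀ n, Tendsto (ρ n) atTop (𝓝 0)) ∧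
                ∀ (n : ℤ) (L : ℕ) [NeZero L], L₀ ≤ L → ∀ (L'' : ℕ) [NeZero L''], L ∣ L'' → ∃ M₀ : ℕ, ∀ (M : ℕ) [NeZero M], M₀ ≤ M →
                  ∀ (ω : MatsubaraIdx M), matsubaraInt M ω = n → ∀ (k : TorusSite 2 L) (k'' : TorusSite 2 L''),
                    latticeMomentum L'' k'' = latticeMomentum L k →
                      ‖klSelfEnergy L M β U μ 0 klE0 (nScales β + 1) (ω, k) 0 -
                          klSelfEnergy L'' M β U μ 0 klE0 (nScales β + 1) (ω, k'') 0‖ ≤ ρ n L) :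
    VolumeLimitP2 Pr FinalTwoLegVolLimitEx W :=
  volumeLimitP2_of_perLabelNestedText Pr W hPr hN (modulusText_holds Pr W)

/-- **A VL child (any `Pr`, `W`) from the PER-LABEL nested export with LABEL-DEPENDENT volume thresholds alone** (`∀ n, ∃ L₀(n) ρ_n → 0, …`). -/
theorem volumeLimitP2_of_perLabelThresholdsOnlyText (Pr : Preds) (W : Set ℝ)
    (hPr : ∀ (R : RenConsts) (U : ℝ) (N : ℕ) (μ : ℝ) (K : TrigPolyC4v), Pr.frameOK R U N μ K → FrameOK R U N μ K)
    (hN : ∀ (G : GeoConsts) (P : SplitConsts) (Q : EngConsts) (R : RenConsts), G.WF → P.WF → Q.WF → R.WF →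
      ∃ c₅ : ℝ, 0 < c₅ ∧ ∀ c : ℝ, 0 < c → c ≤ c₅ → ∃ U₀ : ℝ, 0 < U₀ ∧
        ∀ μ ∈ W, ∀ U : ℝ, 0 < U → U ≤ U₀ → ∀ β : ℝ, klBetaMin ≤ β → β ≤ Real.exp (c / U ^ 2) →
          ∀ K : TrigPolyC4v, Pr.frameOK R U (nScales β) μ K →
            ∀ (Lstar : ℕ) (Mstar : ℕ → ℕ), TowerP Pr G P Q R β U μ K Lstar Mstar →
              ∀ n : ℤ, ∃ L₀ : ℕ, ∃ ρ : ℕ → ℝ, Tendsto ρ atTop (𝓝 0) ∧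
                ∀ (L : ℕ) [NeZero L], L₀ ≤ L → ∀ (L'' : ℕ) [NeZero L''], L ∣ L'' → ∃ M₀ : ℕ, ∀ (M : ℕ) [NeZero M], M₀ ≤ M →
                  ∀ (ω : MatsubaraIdx M), matsubaraInt M ω = n → ∀ (k : TorusSite 2 L) (k'' : TorusSite 2 L''),
                    latticeMomentum L'' k'' = latticeMomentum L k →
                      ‖klSelfEnergy L M β U μ 0 klE0 (nScales β + 1) (ω, k) 0 -
                          klSelfEnergy L'' M β U μ 0 klE0 (nScales β + 1) (ω, k'') 0‖ ≤ ρ L) :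
    VolumeLimitP2 Pr FinalTwoLegVolLimitEx W :=
  volumeLimitP2_of_perLabelThresholdsText Pr W hPr hN (modulusText_holds Pr W)

end Summit.HubbardSuperconductivity.HubbardSuperconductivity.Theorems.TwoPointAssembly

end
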